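import Mathlib
import HarnessLib
import Literature.MathematicalPhysics.QuantumLattice.GrassmannChargeScaling
import Summits.HubbardSuperconductivity.HubbardSuperconductivity.Theorems.KLProgrammeKLRegimeEngineV17F2RowBE4Split

/-!
# Route `KLProgramme` — ENGINE (stmt-HubbardSuperconductivity-20437 `KLRegimeEngineV17F2`), ROW (b): the quartic REMAINDER rows of binders #5/#6 re-keyed
# to the FLUCTUATION PART `𝒱ₙ − V_{Kₙ} = 𝒢_Λ(V_K) − V_K` (the counterterm `𝒩_K` is invisible to every quartic line)
(cell gate-hubbard-kl; visitor seat leafhand-hubbard-klprogramme-3 g0; helper `--supports stmt-HubbardSuperconductivity-20437` toward the registered stub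
`stub_engine_step_norms`; third of the row-(b) split files after `…RowBPlainSplit` (binder #6) and `…RowBE4Split` (binder #5))

`…RowBPlainSplit` / `…RowBE4Split` re-key the two UV-cut plain quartic binders of ★ v22's slot (b) to REMAINDER rows on `𝒱ₙ − V`
(`V = hubbardInteraction L M β U`).  The scale-`n` action is `𝒱ₙ = klEffectiveAction … Kₙ klE0 n = effAction ℂ C^{Kₙ}_{>Λₙ} V_{Kₙ}` with the
COUNTERTERMED vertex `V_{Kₙ} = hubbardInteractionCT L M β U Kₙ = V + 𝒩_{Kₙ}`; since the counterterm `𝒩_K` is quadratic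
(`kernel_counterQuadratic_of_ne_two`) and the UV cut `S_ĝ = ExteriorAlgebra.map (LinearMap.mulLeft ℂ ĝ)` is diagonal on generators (`kernel_map_mulLeft`),
every quartic sectorised kernel of `S_ĝ(G − V)` equals that of `S_ĝ(G − V_K)`:
* `klbv_sectorisedKernel_four_map_mulLeft_counterQuadratic` (`W₄(S_c 𝒩_K) ≡ 0`), **`klbv_sectorisedKernel_four_map_sub_hubbardInteraction_eq_sub_CT`**
  (`W₄(S_c(G − V)) = W₄(S_c(G − V_K))`, any element `G`, frame `K`, multiplier `c`, family `F`);
* **`hrem_of_fluct`** — binder #6's remainder row (hypothesis `hrem` of `…RowBPlainSplit`) from the SAME row on the fluctuation part `𝒱ₙ − V_{Kₙ}`,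
  `Kₙ = klFlowFrameU L M β U μ n`; **`hE₁rem_of_fluct`** — E1's family with the (E4) conjunct on `𝒱ᵢ[Kₙ] − V_{Kₙ}` gives the family with (E4) on
  `𝒱ᵢ[Kₙ] − V` (hypothesis `hE₁rem` of `…RowBE4Split`);
* **`stub_engine_step_norms_of_E1data₃LBcut56_fluct hE₁fl ha′ hb hu₀ hfl hincr′`** ⊢ row (b) VERBATIM — ★ v22 slot (b) with both plain quartic binders keyed to
  the fluctuation parts `effAction − (its own argument)`, the object a tree/loop expansion bounds (BGM 2006 (2.77)–(2.84): all terms with ≥ 1 propagator).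
Honest framing: bookkeeping (an exact identity + two one-application re-keyings); the fluctuation rows are E1-class HYPOTHESES with no supplier in the tree;
nothing here asserts them, row (b), any stub of 20437, K3, U₀, the window or superconductivity.
References: BGM 2006 §2.1 (2.6a), §2.3 (2.23), §2.8 (2.76)–(2.84) [cite: BenfattoGiulianiMastropietro2006]; BGM 2003 §1.2 (2.10) (the counterterm vertex).
-/

noncomputable section

namespace Summit.HubbardSuperconductivity.HubbardSuperconductivity.Theorems.EngineV8.A24a1G14

set_option linter.dupNamespace false -- summit = problem name (single-conjunct summit), D-0017

open Classical
open Real Finset Literature.MathematicalPhysics.QuantumLattice Literature.Probability.LatticeModels GrassmannAlgebra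
open Literature.MathematicalPhysics.QuantumLattice.FermiRG
open Summit.HubbardSuperconductivity.HubbardSuperconductivity.Theorems.KLProgrammeLegKernels
open Summit.HubbardSuperconductivity.HubbardSuperconductivity.Theorems.KLRegimeSplit
open Summit.HubbardSuperconductivity.HubbardSuperconductivity.Theorems.DispersionFlow
open Summit.HubbardSuperconductivity.HubbardSuperconductivity.Theorems.EngineV8

/-! ## §1 The counterterm is invisible to every quartic sectorised line -/

/-- **`W₄(S_c 𝒩_K) ≡ 0`**: the rescaled counterterm vertex has no quartic sectorised kernel (any multiplier family `F`, any rescaling `c`):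
`kernel (S_c 𝒩_K) 4 X = (∏ c(Xᵢ))·kernel 𝒩_K 4 X = 0`. [cite: BenfattoGiulianiMastropietro2003, §1.2 The model (2.10)] -/
theorem klbv_sectorisedKernel_four_map_mulLeft_counterQuadratic {L M N : ℕ} [NeZero L] (β : ℝ) (F : Fin N → FreqMomentum L M → ℂ)
    (c : HubbardFieldIdx L M → ℂ) (K : TrigPolyC4v) :
    sectorisedKernel L M β F (ExteriorAlgebra.map (LinearMap.mulLeft ℂ c) (counterQuadratic L M β K)) 4 = 0 := by
  funext Ω x
  rw [sectorisedKernel_def]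
  refine sum_eq_zero fun k _ => ?_
  rw [kernel_map_mulLeft, kernel_counterQuadratic_of_ne_two β K (by norm_num), mul_zero, mul_zero]

/-- **`W₄(S_c(G − V)) = W₄(S_c(G − V_K))`**: subtracting the bare vertex `V` or the countertermed vertex `V_K = V + 𝒩_K` from any element `G` gives the same
quartic sectorised kernels after any diagonal rescaling `S_c` (the difference is `S_c 𝒩_K`, quartic-invisible). [cite: BenfattoGiulianiMastropietro2003, §1.2 The model (2.10)] -/
theorem klbv_sectorisedKernel_four_map_sub_hubbardInteraction_eq_sub_CT {L M N : ℕ} [NeZero L] (β U : ℝ) (F : Fin N → FreqMomentum L M → ℂ)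
    (c : HubbardFieldIdx L M → ℂ) (K : TrigPolyC4v) (G : HubbardGrassmann L M) :
    sectorisedKernel L M β F (ExteriorAlgebra.map (LinearMap.mulLeft ℂ c) (G - hubbardInteraction L M β U)) 4 =
      sectorisedKernel L M β F (ExteriorAlgebra.map (LinearMap.mulLeft ℂ c) (G - hubbardInteractionCT L M β U K)) 4 := by
  have hsplit : G - hubbardInteraction L M β U = (G - hubbardInteractionCT L M β U K) + counterQuadratic L M β K := by
    rw [hubbardInteractionCT]
    abel
  rw [hsplit, map_add, sectorisedKernel_add, klbv_sectorisedKernel_four_map_mulLeft_counterQuadratic, add_zero]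

/-! ## §2 Binder #6's remainder row from the fluctuation row -/

/-- **Binder #6's REMAINDER row from its FLUCTUATION row**: the hypothesis `hrem` of `hplainE1cut_of_remainder` (row on `𝒱ₙ − V`) follows from the same row
stated on the fluctuation part `𝒱ₙ − V_{Kₙ}`, `Kₙ = klFlowFrameU L M β U μ n`, `V_{Kₙ} = hubbardInteractionCT L M β U Kₙ` — token-identical otherwise
(`klbv_sectorisedKernel_four_map_sub_hubbardInteraction_eq_sub_CT`). [cite: BenfattoGiulianiMastropietro2006, §2.3 (2.23), §2.8 (2.76)-(2.84)] -/
theorem hrem_of_fluct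
    {a' : ℝ} {bfun u₀ : GeoConsts → SplitConsts → RenConsts → EngConsts → ℝ → ℝ}
    (hfl : ∀ (G : GeoConsts), G.WF → ∀ (P : SplitConsts) (R : RenConsts) (Q : EngConsts) (cc : ℝ), P.WF → R.WF2 → Q.WF → 0 < cc →
      cc ≤ klEngC₃6 P R → ∀ μ ∈ klWindowC, ∀ U : ℝ, 0 < U → U ≤ u₀ G P R Q cc →
      ∀ β : ℝ, klBetaMin ≤ β → β ≤ Real.exp (cc / U ^ 2) →
      ∀ (L M : ℕ) [NeZero L] [NeZero M], klEngL₃ β U ≤ L → klEngM₃ β U L ≤ M →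
      ∀ n : ℕ, 1 ≤ n → n ≤ nScales β + 1 → IsKLRegime U cc (-(n : ℤ)) →
        HistP klPredsV17F2 L M G P Q R β U μ 0 n → FrameOK R U (nScales β) μ (klFlowFrameU L M β U μ n) →
        ∀ (τ' : Fin 4 → SectorLeg 1) (y : SpaceTimeIdx L M),
          imagTimeWeight β M ^ 3 * ∑ x' ∈ univ.filter (fun x' : Fin 4 → SpaceTimeIdx L M => x' 0 = y),
            klScaleWt L M β n ((univ.image x').image (fun x : SpaceTimeIdx L M => (((((2 * (x.1 : ℕ) : ℕ)) : ZMod (2 * (2 * M)))), x.2))) *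
              ‖sectorisedKernel L M β (trivialMultiplier L M)
                (ExteriorAlgebra.map (LinearMap.mulLeft ℂ (fun K : HubbardFieldIdx L M => ((gnScaleCutoff 4 klE0 1 |matsubaraFreq β M K.1.1.1| : ℝ) : ℂ)))
                  (klEffectiveAction L M β U μ (klFlowFrameU L M β U μ n) klE0 n - hubbardInteractionCT L M β U (klFlowFrameU L M β U μ n))) 4 τ' x'‖ ≤
          klE0 * (a' * |U| + bfun G P R Q cc * (P.Klam * U) ^ 2)) :
    ∀ (G : GeoConsts), G.WF → ∀ (P : SplitConsts) (R : RenConsts) (Q : EngConsts) (cc : ℝ), P.WF → R.WF2 → Q.WF → 0 < cc →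
      cc ≤ klEngC₃6 P R → ∀ μ ∈ klWindowC, ∀ U : ℝ, 0 < U → U ≤ u₀ G P R Q cc →
      ∀ β : ℝ, klBetaMin ≤ β → β ≤ Real.exp (cc / U ^ 2) →
      ∀ (L M : ℕ) [NeZero L] [NeZero M], klEngL₃ β U ≤ L → klEngM₃ β U L ≤ M →
      ∀ n : ℕ, 1 ≤ n → n ≤ nScales β + 1 → IsKLRegime U cc (-(n : ℤ)) →
        HistP klPredsV17F2 L M G P Q R β U μ 0 n → FrameOK R U (nScales β) μ (klFlowFrameU L M β U μ n) →
        ∀ (τ' : Fin 4 → SectorLeg 1) (y : SpaceTimeIdx L M),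
          imagTimeWeight β M ^ 3 * ∑ x' ∈ univ.filter (fun x' : Fin 4 → SpaceTimeIdx L M => x' 0 = y),
            klScaleWt L M β n ((univ.image x').image (fun x : SpaceTimeIdx L M => (((((2 * (x.1 : ℕ) : ℕ)) : ZMod (2 * (2 * M)))), x.2))) *
              ‖sectorisedKernel L M β (trivialMultiplier L M)
                (ExteriorAlgebra.map (LinearMap.mulLeft ℂ (fun K : HubbardFieldIdx L M => ((gnScaleCutoff 4 klE0 1 |matsubaraFreq β M K.1.1.1| : ℝ) : ℂ)))
                  (klEffectiveAction L M β U μ (klFlowFrameU L M β U μ n) klE0 n - hubbardInteraction L M β U)) 4 τ' x'‖ ≤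
          klE0 * (a' * |U| + bfun G P R Q cc * (P.Klam * U) ^ 2) := by
  intro G hG P R Q cc hP hR hQ hcc hcc6 μ hμ U hU hUu β hβ hβc L M _ _ hL hM n hn1 hn hreg hhist hfr τ' y
  rw [klbv_sectorisedKernel_four_map_sub_hubbardInteraction_eq_sub_CT β U (trivialMultiplier L M) _ (klFlowFrameU L M β U μ n)]
  exact hfl G hG P R Q cc hP hR hQ hcc hcc6 μ hμ U hU hUu β hβ hβc L M hL hM n hn1 hn hreg hhist hfr τ' y

/-! ## §3 E1's row family: the (E4) remainder conjunct from the (E4) fluctuation conjunct -/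

/-- **E1's family with (E4) on the REMAINDER from the family with (E4) on the FLUCTUATION PART**: the hypothesis `hE₁rem` of `hE₁cut_of_remainder`
((E4) on `𝒱ᵢ[Kₙ] − V`) follows from the same family with (E4) stated on `𝒱ᵢ[Kₙ] − V_{Kₙ}` (every level `i ≤ n`, same frame `Kₙ`), (E2)/(E6) and all binders
token-identical. [cite: BenfattoGiulianiMastropietro2006, §2.3 (2.23), §2.8 (2.76)-(2.84)] -/
theorem hE₁rem_of_fluct
    (hE₁fl : ∀ (P : SplitConsts) (R : RenConsts), P.WF → R.WF2 →
      ∃ s₂u s₂c s₄ S₆ : ℝ, 0 ≤ s₂u ∧ 0 ≤ s₂c ∧ 0 ≤ s₄ ∧ 0 ≤ S₆ ∧ ∃ cE UE : ℝ, 0 < cE ∧ 0 < UE ∧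
      ∀ (Q : EngConsts) (cc : ℝ), 0 < cc → cc ≤ klEngC₃6 P R → cc ≤ cE →
      ∀ μ ∈ klWindowC, ∀ U : ℝ, 0 < U → U ≤ klEngU₀10 P R cc → U ≤ UE →
      ∀ β : ℝ, klBetaMin ≤ β → β ≤ Real.exp (cc / U ^ 2) →
      ∀ (L M : ℕ) [NeZero L] [NeZero M], klEngL₄ P R β U ≤ L → klEngM₃ β U L ≤ M →
      ∀ n : ℕ, 1 ≤ n → n ≤ nScales β + 1 → IsKLRegime U cc (-(n : ℤ)) →
      HistP klPredsV17F2 L M klEngGeo14 P Q R β U μ 0 n →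
      (∀ m, 1 ≤ m → m < n → FlowPieceOscAt L M (klReadOscC P R) β U μ m) →
      FrameOK R U (nScales β) μ (klFlowFrameU L M β U μ n) →
      (∀ j ≤ n, LevelsUExportMixedAt L M (klCU2 P R (klEngQ7 P R)) P β U μ j) →
      (∀ i, 1 ≤ i → i ≤ n → ∀ (q : Fin 2) (w : SpaceTimeIdx L M × SectorLeg (sectorCount (i - 1))),
        klWtPinnedSumOf L M β μ (klFlowFrameU L M β U μ n) (i - 1) 2 (klEffectiveAction L M β U μ (klFlowFrameU L M β U μ n) klE0 i) q w ≤
          (s₂u * |U| + s₂c * cc) * ((4 : ℝ) ^ (i - 1))⁻¹) ∧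
      (∀ i, 1 ≤ i → i ≤ n → ∀ (q : Fin 4) (τ' : Fin 4 → SectorLeg 1) (y' : SpaceTimeIdx L M),
        imagTimeWeight β M ^ 3 * ∑ x' ∈ univ.filter (fun x' : Fin 4 → SpaceTimeIdx L M => x' q = y'),
          klScaleWt L M β i ((univ.image x').image (fun x : SpaceTimeIdx L M => (((((2 * (x.1 : ℕ) : ℕ)) : ZMod (2 * (2 * M)))), x.2))) *
            ‖sectorisedKernel L M β (trivialMultiplier L M)
              (ExteriorAlgebra.map (LinearMap.mulLeft ℂ (fun K : HubbardFieldIdx L M => ((gnScaleCutoff 4 klE0 1 |matsubaraFreq β M K.1.1.1| : ℝ) : ℂ)))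
                (klEffectiveAction L M β U μ (klFlowFrameU L M β U μ n) klE0 i - hubbardInteractionCT L M β U (klFlowFrameU L M β U μ n))) 4 τ' x'‖ ≤
            s₄ * epsCoupling P U i) ∧
      (∀ i, 1 ≤ i → i ≤ n → ∀ (q : Fin 6) (w : SpaceTimeIdx L M × SectorLeg (sectorCount (i - 1))),
        klWtPinnedSumOf L M β μ (klFlowFrameU L M β U μ n) (i - 1) 6 (klEffectiveAction L M β U μ (klFlowFrameU L M β U μ n) klE0 i) q w ≤
          S₆ * epsCoupling P U i ^ 2 * (2 : ℝ) ^ (4 * i))) :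
    ∀ (P : SplitConsts) (R : RenConsts), P.WF → R.WF2 →
      ∃ s₂u s₂c s₄ S₆ : ℝ, 0 ≤ s₂u ∧ 0 ≤ s₂c ∧ 0 ≤ s₄ ∧ 0 ≤ S₆ ∧ ∃ cE UE : ℝ, 0 < cE ∧ 0 < UE ∧
      ∀ (Q : EngConsts) (cc : ℝ), 0 < cc → cc ≤ klEngC₃6 P R → cc ≤ cE →
      ∀ μ ∈ klWindowC, ∀ U : ℝ, 0 < U → U ≤ klEngU₀10 P R cc → U ≤ UE →
      ∀ β : ℝ, klBetaMin ≤ β → β ≤ Real.exp (cc / U ^ 2) →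
      ∀ (L M : ℕ) [NeZero L] [NeZero M], klEngL₄ P R β U ≤ L → klEngM₃ β U L ≤ M →
      ∀ n : ℕ, 1 ≤ n → n ≤ nScales β + 1 → IsKLRegime U cc (-(n : ℤ)) →
      HistP klPredsV17F2 L M klEngGeo14 P Q R β U μ 0 n →
      (∀ m, 1 ≤ m → m < n → FlowPieceOscAt L M (klReadOscC P R) β U μ m) →
      FrameOK R U (nScales β) μ (klFlowFrameU L M β U μ n) →
      (∀ j ≤ n, LevelsUExportMixedAt L M (klCU2 P R (klEngQ7 P R)) P β U μ j) →
      (∀ i, 1 ≤ i → i ≤ n → ∀ (q : Fin 2) (w : SpaceTimeIdx L M × SectorLeg (sectorCount (i - 1))),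
        klWtPinnedSumOf L M β μ (klFlowFrameU L M β U μ n) (i - 1) 2 (klEffectiveAction L M β U μ (klFlowFrameU L M β U μ n) klE0 i) q w ≤
          (s₂u * |U| + s₂c * cc) * ((4 : ℝ) ^ (i - 1))⁻¹) ∧
      (∀ i, 1 ≤ i → i ≤ n → ∀ (q : Fin 4) (τ' : Fin 4 → SectorLeg 1) (y' : SpaceTimeIdx L M),
        imagTimeWeight β M ^ 3 * ∑ x' ∈ univ.filter (fun x' : Fin 4 → SpaceTimeIdx L M => x' q = y'),
          klScaleWt L M β i ((univ.image x').image (fun x : SpaceTimeIdx L M => (((((2 * (x.1 : ℕ) : ℕ)) : ZMod (2 * (2 * M)))), x.2))) *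
            ‖sectorisedKernel L M β (trivialMultiplier L M)
              (ExteriorAlgebra.map (LinearMap.mulLeft ℂ (fun K : HubbardFieldIdx L M => ((gnScaleCutoff 4 klE0 1 |matsubaraFreq β M K.1.1.1| : ℝ) : ℂ)))
                (klEffectiveAction L M β U μ (klFlowFrameU L M β U μ n) klE0 i - hubbardInteraction L M β U)) 4 τ' x'‖ ≤ s₄ * epsCoupling P U i) ∧
      (∀ i, 1 ≤ i → i ≤ n → ∀ (q : Fin 6) (w : SpaceTimeIdx L M × SectorLeg (sectorCount (i - 1))),
        klWtPinnedSumOf L M β μ (klFlowFrameU L M β U μ n) (i - 1) 6 (klEffectiveAction L M β U μ (klFlowFrameU L M β U μ n) klE0 i) q w ≤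
          S₆ * epsCoupling P U i ^ 2 * (2 : ℝ) ^ (4 * i)) := by
  intro P R hP hR
  obtain ⟨s₂u, s₂c, s₄, S₆, h2u, h2c, h4, h6, cE, UE, hcE, hUE, H⟩ := hE₁fl P R hP hR
  refine ⟨s₂u, s₂c, s₄, S₆, h2u, h2c, h4, h6, cE, UE, hcE, hUE, ?_⟩
  intro Q cc hcc hcc6 hccE μ hμ U hU hU10 hUUE β hβ hβc L M _ _ hL hM n hn1 hn hreg hhist hosc hfr hlev
  obtain ⟨hE2, hE4, hE6⟩ := H Q cc hcc hcc6 hccE μ hμ U hU hU10 hUUE β hβ hβc L M hL hM n hn1 hn hreg hhist hosc hfr hlev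
  refine ⟨hE2, ?_, hE6⟩
  intro i hi1 hin q τ' y'
  rw [klbv_sectorisedKernel_four_map_sub_hubbardInteraction_eq_sub_CT β U (trivialMultiplier L M) _ (klFlowFrameU L M β U μ n)]
  exact hE4 i hi1 hin q τ' y'

/-! ## §4 The slot-(b) reader keyed to the fluctuation parts -/

/-- **ROW (b) FROM E1-CLASS DATA, BOTH PLAIN QUARTIC BINDERS KEYED TO THE FLUCTUATION PARTS** — ★ v22's slot-(b) reader through `…_remainder₂`, `hE₁rem_of_fluct`
and `hrem_of_fluct`: hypotheses **`hE₁fl`** (E1's (E2)∧(E4)∧(E6) family, (E4) on `𝒱ᵢ[Kₙ] − V_{Kₙ}`), `a′ ≥ 0`, `bfun ≥ 0`, `u₀ > 0`, **`hfl`** (binder #6's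
row on `𝒱ₙ − V_{Kₙ}`), `hincr′` ⊢ row (b) VERBATIM.  Every binder is a HYPOTHESIS; nothing is asserted.
[cite: BenfattoGiulianiMastropietro2006, §2.5-§2.8 (2.52)-(2.84), Lemma 2.5 (2.98), §3 (3.2)-(3.8)] -/
theorem stub_engine_step_norms_of_E1data₃LBcut56_fluct
    (hE₁fl : ∀ (P : SplitConsts) (R : RenConsts), P.WF → R.WF2 →
      ∃ s₂u s₂c s₄ S₆ : ℝ, 0 ≤ s₂u ∧ 0 ≤ s₂c ∧ 0 ≤ s₄ ∧ 0 ≤ S₆ ∧ ∃ cE UE : ℝ, 0 < cE ∧ 0 < UE ∧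
      ∀ (Q : EngConsts) (cc : ℝ), 0 < cc → cc ≤ klEngC₃6 P R → cc ≤ cE →
      ∀ μ ∈ klWindowC, ∀ U : ℝ, 0 < U → U ≤ klEngU₀10 P R cc → U ≤ UE →
      ∀ β : ℝ, klBetaMin ≤ β → β ≤ Real.exp (cc / U ^ 2) →
      ∀ (L M : ℕ) [NeZero L] [NeZero M], klEngL₄ P R β U ≤ L → klEngM₃ β U L ≤ M →
      ∀ n : ℕ, 1 ≤ n → n ≤ nScales β + 1 → IsKLRegime U cc (-(n : ℤ)) →
      HistP klPredsV17F2 L M klEngGeo14 P Q R β U μ 0 n →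
      (∀ m, 1 ≤ m → m < n → FlowPieceOscAt L M (klReadOscC P R) β U μ m) →
      FrameOK R U (nScales β) μ (klFlowFrameU L M β U μ n) →
      (∀ j ≤ n, LevelsUExportMixedAt L M (klCU2 P R (klEngQ7 P R)) P β U μ j) →
      (∀ i, 1 ≤ i → i ≤ n → ∀ (q : Fin 2) (w : SpaceTimeIdx L M × SectorLeg (sectorCount (i - 1))),
        klWtPinnedSumOf L M β μ (klFlowFrameU L M β U μ n) (i - 1) 2 (klEffectiveAction L M β U μ (klFlowFrameU L M β U μ n) klE0 i) q w ≤
          (s₂u * |U| + s₂c * cc) * ((4 : ℝ) ^ (i - 1))⁻¹) ∧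
      (∀ i, 1 ≤ i → i ≤ n → ∀ (q : Fin 4) (τ' : Fin 4 → SectorLeg 1) (y' : SpaceTimeIdx L M),
        imagTimeWeight β M ^ 3 * ∑ x' ∈ univ.filter (fun x' : Fin 4 → SpaceTimeIdx L M => x' q = y'),
          klScaleWt L M β i ((univ.image x').image (fun x : SpaceTimeIdx L M => (((((2 * (x.1 : ℕ) : ℕ)) : ZMod (2 * (2 * M)))), x.2))) *
            ‖sectorisedKernel L M β (trivialMultiplier L M)
              (ExteriorAlgebra.map (LinearMap.mulLeft ℂ (fun K : HubbardFieldIdx L M => ((gnScaleCutoff 4 klE0 1 |matsubaraFreq β M K.1.1.1| : ℝ) : ℂ)))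
                (klEffectiveAction L M β U μ (klFlowFrameU L M β U μ n) klE0 i - hubbardInteractionCT L M β U (klFlowFrameU L M β U μ n))) 4 τ' x'‖ ≤
            s₄ * epsCoupling P U i) ∧
      (∀ i, 1 ≤ i → i ≤ n → ∀ (q : Fin 6) (w : SpaceTimeIdx L M × SectorLeg (sectorCount (i - 1))),
        klWtPinnedSumOf L M β μ (klFlowFrameU L M β U μ n) (i - 1) 6 (klEffectiveAction L M β U μ (klFlowFrameU L M β U μ n) klE0 i) q w ≤
          S₆ * epsCoupling P U i ^ 2 * (2 : ℝ) ^ (4 * i)))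
    {a' : ℝ} (ha' : 0 ≤ a') {bfun u₀ : GeoConsts → SplitConsts → RenConsts → EngConsts → ℝ → ℝ}
    (hb : ∀ G P R Q cc, 0 ≤ bfun G P R Q cc) (hu₀ : ∀ G P R Q cc, 0 < u₀ G P R Q cc)
    (hfl : ∀ (G : GeoConsts), G.WF → ∀ (P : SplitConsts) (R : RenConsts) (Q : EngConsts) (cc : ℝ), P.WF → R.WF2 → Q.WF → 0 < cc →
      cc ≤ klEngC₃6 P R → ∀ μ ∈ klWindowC, ∀ U : ℝ, 0 < U → U ≤ u₀ G P R Q cc →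
      ∀ β : ℝ, klBetaMin ≤ β → β ≤ Real.exp (cc / U ^ 2) →
      ∀ (L M : ℕ) [NeZero L] [NeZero M], klEngL₃ β U ≤ L → klEngM₃ β U L ≤ M →
      ∀ n : ℕ, 1 ≤ n → n ≤ nScales β + 1 → IsKLRegime U cc (-(n : ℤ)) →
        HistP klPredsV17F2 L M G P Q R β U μ 0 n → FrameOK R U (nScales β) μ (klFlowFrameU L M β U μ n) →
        ∀ (τ' : Fin 4 → SectorLeg 1) (y : SpaceTimeIdx L M),
          imagTimeWeight β M ^ 3 * ∑ x' ∈ univ.filter (fun x' : Fin 4 → SpaceTimeIdx L M => x' 0 = y),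
            klScaleWt L M β n ((univ.image x').image (fun x : SpaceTimeIdx L M => (((((2 * (x.1 : ℕ) : ℕ)) : ZMod (2 * (2 * M)))), x.2))) *
              ‖sectorisedKernel L M β (trivialMultiplier L M)
                (ExteriorAlgebra.map (LinearMap.mulLeft ℂ (fun K : HubbardFieldIdx L M => ((gnScaleCutoff 4 klE0 1 |matsubaraFreq β M K.1.1.1| : ℝ) : ℂ)))
                  (klEffectiveAction L M β U μ (klFlowFrameU L M β U μ n) klE0 n - hubbardInteractionCT L M β U (klFlowFrameU L M β U μ n))) 4 τ' x'‖ ≤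
          klE0 * (a' * |U| + bfun G P R Q cc * (P.Klam * U) ^ 2))
    (hincr : ∀ (P : SplitConsts) (R : RenConsts), P.WF → R.WF2 →
      ∃ Bw : ℝ, 0 ≤ Bw ∧ ∃ uI : EngConsts → ℝ → ℝ, (∀ Q cc, 0 < uI Q cc) ∧ ∃ cI : ℝ, 0 < cI ∧
      ∀ Q : EngConsts, (klEngQ7 P R).IsRaiseOf Q →
      ∀ cc : ℝ, 0 < cc → cc ≤ klEngC₃6 P R → cc ≤ cI →
      ∀ μ ∈ klWindowC, ∀ U : ℝ, 0 < U → U ≤ klEngU₀10 P R cc → U ≤ uI Q cc →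
      ∀ β : ℝ, klBetaMin ≤ β → β ≤ Real.exp (cc / U ^ 2) →
      ∀ (L M : ℕ) [NeZero L] [NeZero M], klEngL₄ P R β U ≤ L → klEngM₃ β U L ≤ M →
      ∀ n : ℕ, 1 ≤ n → n ≤ nScales β + 1 →
        HistP klPredsV17F2 L M klEngGeo14 P Q R β U μ 0 n → FrameOK R U (nScales β) μ (klFlowFrameU L M β U μ n) →
        ∃ b : ℕ → ℝ, (∑ j ∈ range n, (klScale klE0 (j + 1))⁻¹ * b j ≤ Bw) ∧
          ∀ j < n, ∀ w : GridLeg (GridPoint L (2 * (2 * M))),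
            ∑ Y ∈ univ.filter (fun Y : Fin 2 → GridLeg (GridPoint L (2 * (2 * M))) => Y 0 = w),
              (klScaleWt L M β (j + 1) ((univ.image Y).image gridLegPos) - 1) *
                ‖kernel ℂ
                  (effAction ℂ ((hubbardGridSub L M β (2 * (2 * M))).transpose *
                      hubbardCovAboveCT L M β μ 0 (klFlowFrameU L M β U μ n) (klScale klE0 (j + 1)) * hubbardGridSub L M β (2 * (2 * M)))
                    (hubbardGridInteraction L (2 * (2 * M)) β U + hubbardGridCounterQuadratic L (2 * (2 * M)) β (klFlowFrameU L M β U μ n)) -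
                  effAction ℂ ((hubbardGridSub L M β (2 * (2 * M))).transpose *
                      hubbardCovAboveCT L M β μ 0 (klFlowFrameU L M β U μ n) (klScale klE0 j) * hubbardGridSub L M β (2 * (2 * M)))
                    (hubbardGridInteraction L (2 * (2 * M)) β U + hubbardGridCounterQuadratic L (2 * (2 * M)) β (klFlowFrameU L M β U μ n))) 2 Y‖ ≤
              b j * U ^ 2 * (β / (2 * ((2 * (2 * M) : ℕ) : ℝ)))) :
    ∀ (P : SplitConsts) (R : RenConsts) (c : ℝ), P.WF → R.WF2 → 0 < c → c ≤ klEngC₃7GU klEngGeo14 P R →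
      ∀ μ ∈ klWindowC, ∀ U : ℝ, 0 < U → U ≤ klEngU₀12GQ klEngGeo14 (klEngQ9dG klEngGeo14 P R) P R c → ∀ β : ℝ, klBetaMin ≤ β → β ≤ Real.exp (c / U ^ 2) →
        ∀ (L M : ℕ) [NeZero L] [NeZero M], klEngL₄ P R β U ≤ L → klEngM₃ β U L ≤ M →
          ∀ n : ℕ, 1 ≤ n → n ≤ nScales β + 1 → IsKLRegime U c (-(n : ℤ)) →
            HistP klPredsV17F2 L M klEngGeo14 P (klEngQ9dG klEngGeo14 P R) R β U μ 0 n →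
              (∀ m, 1 ≤ m → m < n → FlowPieceOscAt L M (klReadOscC P R) β U μ m) →
              FrameOK R U (nScales β) μ (klFlowFrameU L M β U μ n) →
                (∀ j ≤ n, LevelsUExportMixedAt L M (klCU2 P R (klEngQ7 P R)) P β U μ j) →
                  KernelNormsV4 L M P (klEngQ9dG klEngGeo14 P R) β U μ (klFlowFrameU L M β U μ n) n ∧
                    (∀ j ≤ n, (KernelNormsLevels L M P (klEngQ9dG klEngGeo14 P R) β U μ (klFlowFrameU L M β U μ n) j ∧
                      KernelNormsWt4 L M (klWtBudget P (klEngQ9dG klEngGeo14 P R) U j) β U μ (klFlowFrameU L M β U μ n) j)) ∧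
                    EngineFirstMoments L M klEngGeo14 P (klEngQ9dG klEngGeo14 P R) β U μ (klFlowFrameU L M β U μ n) n ∧
                    IsoFirstMomentsAt L M klIsoMomC (klIsoMomD P R) P β U μ n ∧
                    TwoLegGridFlowMomentsAtC L M (klZtG klEngGeo14 P R) (klZs1G klEngGeo14 P R) (klZs2G klEngGeo14 P R) c β U μ n :=
  stub_engine_step_norms_of_E1data₃LBcut56_remainder₂ (hE₁rem_of_fluct hE₁fl) ha' hb hu₀ (hrem_of_fluct hfl) hincr

end Summit.HubbardSuperconductivity.HubbardSuperconductivity.Theorems.EngineV8.A24a1G14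

end
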